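import Summits.QuantumAdvantage.AdviceFreeQNC0.LDMATransfer
import Summits.QuantumAdvantage.AdviceFreeQNC0.WeightClassSumsets
import HarnessLib

/-!
# Cell qa-qnc0 (rung F-Q1, route RingFrame, crux α, line `product`): character sums for the joint
# Hamming-weight residues mod 3 of an affine family of cube vertices

The Fourier engine behind `CubeCover` (planner qa-qnc0-p1 THEOREM-TARGET T6(b), HOME/qa-qnc0-p1/
ROUND-8.md §1(b)): a family of "vertices" `j ∈ V`, each a point of `{0,1}^L` whose `ℓ`-th bit is
`c j ℓ ⊕ φ j (a ℓ)` for a configuration `a : Fin L → G` of independent columns `a ℓ ∈ t ℓ ⊆ G`.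
For a target residue `r`, the number `N` of configurations ALL of whose vertices have Hamming weight
`≡ r (mod 3)` satisfies (`ω = e^{2πi/3}`, characters `ξ : V → ℤ/3`)

* `three_pow_mul_count_eq`: `3^{|V|}·N = Σ_ξ ω^{2r·Σ_j ξ_j} · Π_ℓ S_ℓ(ξ)` with the COLUMN SUMS
  `S_ℓ(ξ) = Σ_{α ∈ t ℓ} ω^{phase_ℓ(ξ, α)}`, `phase_ℓ(ξ, α) = Σ_j ξ_j·[c j ℓ ⊕ φ j α]`
  (orthogonality `1 + ω^m + ω^{2m} = 3·[3 ∣ m]` per vertex, then the product over columns);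
* `norm_colSum_le` / `norm_colSum_le_sub_one`: `|S_ℓ(ξ)| ≤ #t ℓ`, and `≤ #t ℓ − 1` as soon as the
  phase is NOT constant mod 3 on `t ℓ` (two unequal cube roots of unity sum to a unit vector);
* `abs_three_pow_mul_count_sub_le`: hence, if every `#t ℓ = K` and every non-trivial character has at
  least `m ξ` columns with non-constant phase, `|3^{|V|}·N − K^L| ≤ Σ_{ξ ≠ 0} K^L·(1 − 1/K)^{m ξ}`, and
  `abs_three_pow_mul_count_sub_le_uniform`: `≤ 3^{|V|}·K^L·(1 − 1/K)^m` for a uniform `m`.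

No cube geometry here (that is `CubeCover*.lean`); this file is the abstract equidistribution count.
WHAT THIS IS NOT: nothing on `FSB`/`FW`/α; no separation claim.  [folklore: Fourier analysis on
`(ℤ/3)^V` for sums of independent steps]
-/

noncomputable section

namespace Summit.QuantumAdvantage.AdviceFreeQNC0

open Finset

namespace CubeChar

variable {L : ℕ} {G : Type*} {V : Type*} [Fintype V]

/-- The `j`-th vertex of the configuration `a`: bit `ℓ` is `c j ℓ ⊕ φ j (a ℓ)`. -/
def vtx (c : V → Fin L → Bool) (φ : V → G → Bool) (a : Fin L → G) (j : V) : Fin L → Bool :=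
  fun ℓ => xor (c j ℓ) (φ j (a ℓ))

/-- The phase of the character `ξ` picked up in column `ℓ` at the column value `α`. -/
def phase (c : V → Fin L → Bool) (φ : V → G → Bool) (ξ : V → ZMod 3) (ℓ : Fin L) (α : G) : ℕ :=
  ∑ j, (ξ j).val * (if xor (c j ℓ) (φ j α) = true then 1 else 0)

/-- The column sum `S_ℓ(ξ) = Σ_{α ∈ t ℓ} ω^{phase}`. -/
def colSum (c : V → Fin L → Bool) (φ : V → G → Bool) (t : Fin L → Finset G) (ξ : V → ZMod 3)
    (ℓ : Fin L) : ℂ :=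
  ∑ α ∈ t ℓ, omega3 ^ phase c φ ξ ℓ α

/-- The number of configurations over `t` all of whose vertices have weight `≡ r (mod 3)`. -/
def count [DecidableEq G] (c : V → Fin L → Bool) (φ : V → G → Bool) (t : Fin L → Finset G)
    (r : ℕ) : ℕ :=
  ((Fintype.piFinset t).filter fun a => ∀ j, vtx c φ a j ∈ cls L r).card

/-! ### Orthogonality of the cube roots of unity -/

/-- `Σ_{s ∈ ℤ/3} ω^{s·m} = 3·[m ≡ 0 (3)]`. -/
theorem sum_omega3_pow_val_mul (m : ℕ) :
    ∑ s : ZMod 3, omega3 ^ (s.val * m) = if m % 3 = 0 then 3 else 0 := by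
  rw [← one_add_omega3_pow_add_omega3_pow_two_mul m]
  change ∑ s : Fin 3, omega3 ^ ((s : ZMod 3).val * m) = _
  rw [Fin.sum_univ_three]
  have h0 : ((0 : Fin 3) : ZMod 3).val = 0 := rfl
  have h1 : ((1 : Fin 3) : ZMod 3).val = 1 := rfl
  have h2 : ((2 : Fin 3) : ZMod 3).val = 2 := rfl
  rw [h0, h1, h2, zero_mul, pow_zero, one_mul]

/-- The class indicator as a character sum: `3·[m ≡ r (3)] = Σ_s ω^{s(m + 2r)}`. -/
theorem three_mul_indicator_eq (m r : ℕ) :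
    (if m % 3 = r % 3 then (3 : ℂ) else 0) = ∑ s : ZMod 3, omega3 ^ (s.val * (m + 2 * r)) := by
  rw [sum_omega3_pow_val_mul]
  by_cases h : m % 3 = r % 3
  · rw [if_pos h, if_pos (by omega)]
  · rw [if_neg h, if_neg (by omega)]

/-! ### The counting identity -/

/-- `Π_j 3·[w_j ≡ r] = 3^{|V|}·[∀ j, w_j ≡ r]`. -/
theorem prod_indicator_eq (w : V → ℕ) (r : ℕ) :
    ∏ j, (if w j % 3 = r % 3 then (3 : ℂ) else 0) =
      if ∀ j, w j % 3 = r % 3 then (3 : ℂ) ^ Fintype.card V else 0 := by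
  by_cases h : ∀ j, w j % 3 = r % 3
  · rw [if_pos h, Finset.prod_congr rfl fun j _ => if_pos (h j), Finset.prod_const, Finset.card_univ]
  · rw [if_neg h]
    push Not at h
    obtain ⟨j, hj⟩ := h
    exact Finset.prod_eq_zero (Finset.mem_univ j) (if_neg hj)

/-- The weight phase of one configuration factors over the columns:
`Σ_j ξ_j·|vtx_j(a)| = Σ_ℓ phase_ℓ(ξ, a ℓ)`. -/
theorem sum_val_mul_wt_eq (c : V → Fin L → Bool) (φ : V → G → Bool) (ξ : V → ZMod 3)
    (a : Fin L → G) : ∑ j, (ξ j).val * wt (vtx c φ a j) = ∑ ℓ, phase c φ ξ ℓ (a ℓ) := by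
  unfold phase
  rw [Finset.sum_comm]
  refine Finset.sum_congr rfl fun j _ => ?_
  unfold wt vtx
  rw [Finset.card_filter, Finset.mul_sum]

/-- **The counting identity.** `3^{|V|}·N = Σ_ξ ω^{2r Σ_j ξ_j} Π_ℓ S_ℓ(ξ)`. -/
theorem three_pow_mul_count_eq [DecidableEq G] [DecidableEq V] (c : V → Fin L → Bool)
    (φ : V → G → Bool) (t : Fin L → Finset G) (r : ℕ) :
    (3 : ℂ) ^ Fintype.card V * (count c φ t r : ℂ) =
      ∑ ξ : V → ZMod 3, omega3 ^ (2 * r * ∑ j, (ξ j).val) * ∏ ℓ, colSum c φ t ξ ℓ := by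
  classical
  -- `3^{|V|}·N = Σ_a Π_j 3[w_j(a) ≡ r]`
  have h1 : (3 : ℂ) ^ Fintype.card V * (count c φ t r : ℂ) =
      ∑ a ∈ Fintype.piFinset t, ∏ j, (if wt (vtx c φ a j) % 3 = r % 3 then (3 : ℂ) else 0) := by
    unfold count
    rw [Finset.card_filter, Nat.cast_sum, Finset.mul_sum]
    refine Finset.sum_congr rfl fun a _ => ?_
    rw [prod_indicator_eq]
    have e : (∀ j, vtx c φ a j ∈ cls L r) ↔ ∀ j, wt (vtx c φ a j) % 3 = r % 3 := by
      unfold cls; simp only [Finset.mem_filter, Finset.mem_univ, true_and]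
    by_cases h : ∀ j, wt (vtx c φ a j) % 3 = r % 3
    · rw [if_pos h, if_pos (e.2 h)]; simp
    · rw [if_neg h, if_neg (fun h' => h (e.1 h'))]; simp
  -- expand each indicator and multiply out
  have h2 : ∀ a : Fin L → G, ∏ j, (if wt (vtx c φ a j) % 3 = r % 3 then (3 : ℂ) else 0) =
      ∑ ξ : V → ZMod 3, omega3 ^ (2 * r * ∑ j, (ξ j).val) * ∏ ℓ, omega3 ^ phase c φ ξ ℓ (a ℓ) := by
    intro a
    simp_rw [three_mul_indicator_eq]
    rw [Fintype.prod_sum]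
    refine Finset.sum_congr rfl fun ξ _ => ?_
    have e : ∀ j, omega3 ^ ((ξ j).val * (wt (vtx c φ a j) + 2 * r)) =
        omega3 ^ (2 * r * (ξ j).val) * omega3 ^ ((ξ j).val * wt (vtx c φ a j)) := by
      intro j; rw [← pow_add]; congr 1; ring
    rw [Finset.prod_congr rfl fun j _ => e j, Finset.prod_mul_distrib, Finset.prod_pow_eq_pow_sum,
      Finset.prod_pow_eq_pow_sum, ← Finset.mul_sum, sum_val_mul_wt_eq, ← Finset.prod_pow_eq_pow_sum]
  rw [h1, Finset.sum_congr rfl fun a _ => h2 a, Finset.sum_comm]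
  refine Finset.sum_congr rfl fun ξ _ => ?_
  rw [← Finset.mul_sum]
  congr 1
  unfold colSum
  exact (Finset.prod_univ_sum t fun ℓ α => omega3 ^ phase c φ ξ ℓ α).symm

/-! ### Column bounds -/

/-- `‖ω^k‖ = 1`. -/
theorem norm_omega3_pow (k : ℕ) : ‖omega3 ^ k‖ = 1 := by rw [norm_pow, norm_omega3, one_pow]

/-- Two distinct cube roots of unity sum to a unit vector: `‖ω^p + ω^q‖ = 1` for `p ≢ q (3)`. -/
theorem norm_omega3_pow_add_pow {p q : ℕ} (h : p % 3 ≠ q % 3) : ‖omega3 ^ p + omega3 ^ q‖ = 1 := by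
  rw [omega3_pow_eq_pow_mod p, omega3_pow_eq_pow_mod q]
  have hp : p % 3 < 3 := Nat.mod_lt _ (by norm_num)
  have hq : q % 3 < 3 := Nat.mod_lt _ (by norm_num)
  have key : ∀ a b : ℕ, a < 3 → b < 3 → a ≠ b → ‖omega3 ^ a + omega3 ^ b‖ = 1 := by
    intro a b ha hb hab
    have e01 : ‖omega3 ^ 0 + omega3 ^ 1‖ = 1 := by
      have e : omega3 ^ 0 + omega3 ^ 1 = -omega3 ^ 2 := by linear_combination one_add_omega3_add_sq
      rw [e, norm_neg, norm_pow, norm_omega3, one_pow]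
    have e02 : ‖omega3 ^ 0 + omega3 ^ 2‖ = 1 := by
      have e : omega3 ^ 0 + omega3 ^ 2 = -omega3 := by linear_combination one_add_omega3_add_sq
      rw [e, norm_neg, norm_omega3]
    have e12 : ‖omega3 ^ 1 + omega3 ^ 2‖ = 1 := by
      have e : omega3 ^ 1 + omega3 ^ 2 = -1 := by linear_combination one_add_omega3_add_sq
      rw [e, norm_neg, norm_one]
    interval_cases a <;> interval_cases b <;> first
      | exact absurd rfl hab | exact e01 | exact e02 | exact e12
      | (rw [add_comm]; first | exact e01 | exact e02 | exact e12)
  exact key _ _ hp hq h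

/-- The trivial column bound `‖S_ℓ(ξ)‖ ≤ #t ℓ`. -/
theorem norm_colSum_le (c : V → Fin L → Bool) (φ : V → G → Bool) (t : Fin L → Finset G)
    (ξ : V → ZMod 3) (ℓ : Fin L) : ‖colSum c φ t ξ ℓ‖ ≤ (t ℓ).card := by
  unfold colSum
  refine (norm_sum_le _ _).trans ?_
  rw [Finset.sum_congr rfl fun α _ => norm_omega3_pow _, Finset.sum_const, nsmul_eq_mul, mul_one]

/-- The cancelling column bound: if the phase is not constant mod 3 on `t ℓ`, then
`‖S_ℓ(ξ)‖ ≤ #t ℓ − 1`. -/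
theorem norm_colSum_le_sub_one [DecidableEq G] (c : V → Fin L → Bool) (φ : V → G → Bool) (t : Fin L → Finset G)
    (ξ : V → ZMod 3) (ℓ : Fin L) {α β : G} (hα : α ∈ t ℓ) (hβ : β ∈ t ℓ)
    (h : phase c φ ξ ℓ α % 3 ≠ phase c φ ξ ℓ β % 3) : ‖colSum c φ t ξ ℓ‖ ≤ (t ℓ).card - 1 := by
  have hne : β ≠ α := fun e => h (by rw [e])
  have hβ' : β ∈ (t ℓ).erase α := Finset.mem_erase.2 ⟨hne, hβ⟩
  unfold colSum
  rw [← Finset.add_sum_erase _ _ hα, ← Finset.add_sum_erase _ _ hβ', ← add_assoc]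
  have hcard : (((t ℓ).erase α).erase β).card = (t ℓ).card - 2 := by
    rw [Finset.card_erase_of_mem hβ', Finset.card_erase_of_mem hα]; omega
  have h2 : 2 ≤ (t ℓ).card := by
    have := Finset.card_pos.2 ⟨β, hβ'⟩
    rw [Finset.card_erase_of_mem hα] at this; omega
  refine (norm_add_le _ _).trans ?_
  rw [norm_omega3_pow_add_pow h]
  have hrest : ‖∑ x ∈ ((t ℓ).erase α).erase β, omega3 ^ phase c φ ξ ℓ x‖ ≤ ((t ℓ).card - 2 : ℕ) := by
    refine (norm_sum_le _ _).trans ?_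
    rw [Finset.sum_congr rfl fun γ _ => norm_omega3_pow _, Finset.sum_const, nsmul_eq_mul, mul_one,
      hcard]
  have e : (((t ℓ).card - 2 : ℕ) : ℝ) = ((t ℓ).card : ℝ) - 2 := by
    rw [Nat.cast_sub h2]; norm_num
  rw [e] at hrest
  linarith

/-- The product of the column bounds: with all `#t ℓ = K` and at least `m` columns of non-constant
phase, `Π_ℓ ‖S_ℓ(ξ)‖ ≤ K^L·(1 − 1/K)^m`. -/
theorem prod_norm_colSum_le [DecidableEq G] (c : V → Fin L → Bool) (φ : V → G → Bool) (t : Fin L → Finset G)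
    {K : ℕ} (hK : ∀ ℓ, (t ℓ).card = K) (hKpos : 0 < K) (ξ : V → ZMod 3) {m : ℕ}
    (hm : m ≤ (univ.filter fun ℓ : Fin L => ∃ α ∈ t ℓ, ∃ β ∈ t ℓ,
      phase c φ ξ ℓ α % 3 ≠ phase c φ ξ ℓ β % 3).card) :
    ∏ ℓ, ‖colSum c φ t ξ ℓ‖ ≤ (K : ℝ) ^ L * (1 - 1 / K) ^ m := by
  classical
  set C := univ.filter fun ℓ : Fin L => ∃ α ∈ t ℓ, ∃ β ∈ t ℓ,
      phase c φ ξ ℓ α % 3 ≠ phase c φ ξ ℓ β % 3 with hC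
  have hKr : (0 : ℝ) < K := by exact_mod_cast hKpos
  have hq0 : (0 : ℝ) ≤ 1 - 1 / K := by
    rw [sub_nonneg, div_le_one hKr]; exact_mod_cast hKpos
  have hq1 : (1 : ℝ) - 1 / K ≤ 1 := by
    have : (0 : ℝ) ≤ 1 / K := by positivity
    linarith
  -- pointwise bound by `K·(1 − 1/K)` on `C` and by `K` elsewhere
  have hpt : ∀ ℓ, ‖colSum c φ t ξ ℓ‖ ≤ if ℓ ∈ C then (K : ℝ) * (1 - 1 / K) else K := by
    intro ℓ
    split_ifs with hℓ
    · obtain ⟨α, hα, β, hβ, hne⟩ := (Finset.mem_filter.1 hℓ).2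
      have := norm_colSum_le_sub_one c φ t ξ ℓ hα hβ hne
      rw [hK ℓ] at this
      have e : (K : ℝ) * (1 - 1 / K) = K - 1 := by field_simp
      rw [e]; exact this
    · have := norm_colSum_le c φ t ξ ℓ
      rw [hK ℓ] at this; exact this
  calc ∏ ℓ, ‖colSum c φ t ξ ℓ‖ ≤ ∏ ℓ, (if ℓ ∈ C then (K : ℝ) * (1 - 1 / K) else K) :=
        Finset.prod_le_prod (fun ℓ _ => norm_nonneg _) fun ℓ _ => hpt ℓ
    _ = ((K : ℝ) * (1 - 1 / K)) ^ C.card * (K : ℝ) ^ (L - C.card) := by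
        rw [Finset.prod_ite, Finset.prod_const, Finset.prod_const]
        congr 2
        · rw [Finset.filter_mem_eq_inter, Finset.univ_inter]
        · rw [Finset.filter_not, Finset.filter_mem_eq_inter, Finset.univ_inter,
            Finset.card_sdiff_of_subset (Finset.subset_univ C), Finset.card_univ, Fintype.card_fin]
    _ = (K : ℝ) ^ L * (1 - 1 / K) ^ C.card := by
        have hCL : C.card ≤ L := (Finset.card_le_univ C).trans_eq (Fintype.card_fin L)
        rw [mul_pow, mul_comm ((K : ℝ) ^ C.card), mul_assoc, ← pow_add, Nat.add_sub_cancel' hCL,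
          mul_comm]
    _ ≤ (K : ℝ) ^ L * (1 - 1 / K) ^ m :=
        mul_le_mul_of_nonneg_left (pow_le_pow_of_le_one hq0 hq1 hm) (by positivity)

/-! ### The deviation from equidistribution -/

/-- The trivial character contributes the main term `Π_ℓ #t ℓ`. -/
theorem colSum_zero (c : V → Fin L → Bool) (φ : V → G → Bool) (t : Fin L → Finset G) (ℓ : Fin L) :
    colSum c φ t 0 ℓ = (t ℓ).card := by
  unfold colSum phase
  simp

/-- **Deviation bound.** With all `#t ℓ = K > 0` and, for every non-trivial character `ξ`, at least
`m ξ` columns of non-constant phase: `|3^{|V|}·N − K^L| ≤ Σ_{ξ ≠ 0} K^L (1 − 1/K)^{m ξ}`. -/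
theorem abs_three_pow_mul_count_sub_le [DecidableEq G] [DecidableEq V] (c : V → Fin L → Bool)
    (φ : V → G → Bool) (t : Fin L → Finset G) (r : ℕ) {K : ℕ} (hK : ∀ ℓ, (t ℓ).card = K) (hKpos : 0 < K)
    (m : (V → ZMod 3) → ℕ)
    (hm : ∀ ξ : V → ZMod 3, ξ ≠ 0 → m ξ ≤ (univ.filter fun ℓ : Fin L => ∃ α ∈ t ℓ, ∃ β ∈ t ℓ,
      phase c φ ξ ℓ α % 3 ≠ phase c φ ξ ℓ β % 3).card) :
    |(3 : ℝ) ^ Fintype.card V * (count c φ t r : ℝ) - (K : ℝ) ^ L| ≤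
      ∑ ξ ∈ (univ : Finset (V → ZMod 3)).erase 0, (K : ℝ) ^ L * (1 - 1 / K) ^ m ξ := by
  classical
  have hid := three_pow_mul_count_eq c φ t r
  rw [← Finset.add_sum_erase _ _ (Finset.mem_univ (0 : V → ZMod 3))] at hid
  have h0 : omega3 ^ (2 * r * ∑ j, ((0 : V → ZMod 3) j).val) * ∏ ℓ, colSum c φ t 0 ℓ =
      ((K : ℂ)) ^ L := by
    simp only [Pi.zero_apply, ZMod.val_zero, Finset.sum_const_zero, mul_zero, pow_zero, one_mul]
    rw [Finset.prod_congr rfl fun ℓ _ => colSum_zero c φ t ℓ]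
    simp_rw [hK]
    rw [Finset.prod_const, Finset.card_univ, Fintype.card_fin]
  rw [h0] at hid
  have hdiff : ((3 : ℂ) ^ Fintype.card V * (count c φ t r : ℂ) - (K : ℂ) ^ L) =
      ∑ ξ ∈ (univ : Finset (V → ZMod 3)).erase 0,
        omega3 ^ (2 * r * ∑ j, (ξ j).val) * ∏ ℓ, colSum c φ t ξ ℓ := by
    rw [hid]; ring
  have hC : ‖(((3 : ℝ) ^ Fintype.card V * (count c φ t r : ℝ) - (K : ℝ) ^ L : ℝ) : ℂ)‖ =
      |(3 : ℝ) ^ Fintype.card V * (count c φ t r : ℝ) - (K : ℝ) ^ L| := by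
    rw [Complex.norm_real, Real.norm_eq_abs]
  have hcast : (((3 : ℝ) ^ Fintype.card V * (count c φ t r : ℝ) - (K : ℝ) ^ L : ℝ) : ℂ) =
      (3 : ℂ) ^ Fintype.card V * (count c φ t r : ℂ) - (K : ℂ) ^ L := by push_cast; rfl
  rw [← hC, hcast, hdiff]
  refine (norm_sum_le _ _).trans (Finset.sum_le_sum fun ξ hξ => ?_)
  rw [norm_mul, norm_omega3_pow, one_mul, norm_prod]
  exact prod_norm_colSum_le c φ t hK hKpos ξ (hm ξ (Finset.ne_of_mem_erase hξ))

/-- **Deviation bound, uniform form.** If every non-trivial character has `≥ m` columns of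
non-constant phase then `|3^{|V|}·N − K^L| ≤ 3^{|V|}·K^L·(1 − 1/K)^m`. -/
theorem abs_three_pow_mul_count_sub_le_uniform [DecidableEq G] [DecidableEq V]
    (c : V → Fin L → Bool) (φ : V → G → Bool) (t : Fin L → Finset G) (r : ℕ) {K : ℕ} (hK : ∀ ℓ, (t ℓ).card = K) (hKpos : 0 < K) {m : ℕ}
    (hm : ∀ ξ : V → ZMod 3, ξ ≠ 0 → m ≤ (univ.filter fun ℓ : Fin L => ∃ α ∈ t ℓ, ∃ β ∈ t ℓ,
      phase c φ ξ ℓ α % 3 ≠ phase c φ ξ ℓ β % 3).card) :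
    |(3 : ℝ) ^ Fintype.card V * (count c φ t r : ℝ) - (K : ℝ) ^ L| ≤
      (3 : ℝ) ^ Fintype.card V * ((K : ℝ) ^ L * (1 - 1 / K) ^ m) := by
  classical
  refine (abs_three_pow_mul_count_sub_le c φ t r hK hKpos (fun _ => m) hm).trans ?_
  rw [Finset.sum_const, nsmul_eq_mul]
  refine mul_le_mul_of_nonneg_right ?_ (by
    have hKr : (0 : ℝ) < K := by exact_mod_cast hKpos
    have hq0 : (0 : ℝ) ≤ 1 - 1 / K := by
      rw [sub_nonneg, div_le_one hKr]; exact_mod_cast hKpos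
    positivity)
  have hcard : (((univ : Finset (V → ZMod 3)).erase 0).card : ℝ) ≤ (3 : ℝ) ^ Fintype.card V := by
    have h1 : ((univ : Finset (V → ZMod 3)).erase 0).card ≤ (univ : Finset (V → ZMod 3)).card :=
      Finset.card_erase_le
    rw [Finset.card_univ, Fintype.card_fun, ZMod.card] at h1
    exact_mod_cast h1
  exact hcard

end CubeChar

end Summit.QuantumAdvantage.AdviceFreeQNC0

end
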